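import Summits.ValiantsHypothesis.ValiantsHypothesis.Theorems.KPlusLogSqLawTridiagonalRealStaticEqualSpeedAll
import Summits.ValiantsHypothesis.ValiantsHypothesis.Theorems.KPlusLogSqLawTridiagonalRealStaticTyped

/-!
# Route «KPlusLogSqLaw», crux `WeakLifting` (stmt-ValiantsHypothesis-19561) — REAL side of the tridiagonal sector:
# the EQUAL-SPEED ROW in the desk's typed matrix currency — `max Z = m − 1` on typed equal-speed designs, all sizes

HONEST FRAMING.  Helper (`--supports stmt-ValiantsHypothesis-19561 --as helper`), seat val-sym-lift-p2 (g16), cell `pub-symmetroid`, 2026-08-28;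
α register, EQUAL-SPEED SECTOR, typed currency of the desk's α target (`Matrix.det (Matrix.of fun i j => C (c i j) * X ^ (e i j))`, `c`, `e` symmetric,
`c = 0` off the band, `0 < c i i`; lead R2102/R2114).  A typed design is EQUAL-SPEED if `2·e(t,t+1) − e(t,t) − e(t+1,t+1) ∈ {L, −L}` for all `t + 1 < m`.
* UPPER (p639113, `SlopeSumRow.card_posRoots_det_le_of_equalSpeed`): every typed equal-speed design has `Z ≤ m − 1`.
* LOWER (this file, from p643266 `exists_equalSpeed_card_eq` through val-sym-lift-p3 g14's typing pattern): **`exists_typed_equalSpeed_card_eq` — for every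
  `m ≥ 1` there is a typed static DEFINITE symmetric tridiagonal design with slopes `2·e(t,t+1) − e(t,t) − e(t+1,t+1) ∈ {2, −2}` and EXACTLY `m − 1` distinct
  positive determinant zeros**; `not_equalSpeed_law_lt` — no row `B m < m − 1` is a law on the typed equal-speed sector.
So the typed equal-speed sector's register is `m − 1` for all sizes (kernel, two-sided).  Nothing here bears on the full register (α NO MOVER), on `WeakLifting` /
`TropicalB` (stmt-19771) in their windows, on Conjecture B, on the Door-A registers, on `MatrixDescartes` (stmt-ValiantsHypothesis-18050) or on VP ≠ VNP.
[this seat; typing pattern of `…TridiagonalRealStaticTyped`]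
-/

set_option linter.dupNamespace false
set_option autoImplicit false

namespace Summit.ValiantsHypothesis.ValiantsHypothesis.Theorems.KPlusLogSqLaw

namespace SlopeSumRow

open Polynomial Finset
open Summit.ValiantsHypothesis.ValiantsHypothesis.Theorems.KPlusLogSqLaw.StaticTridiagonalRealPotential
  (pathDet pathDet_congr det_of_eq_pathDet)

/-- **THE EQUAL-SPEED ROW IN THE TYPED CURRENCY (all sizes).**  For every `m ≥ 1` there is a typed static definite symmetric tridiagonal monomial matrix
(`c`, `e` symmetric, `c = 0` off the band, `0 < c i i`) whose edge slopes `2 e(t,t+1) − e(t,t) − e(t+1,t+1)` all lie in `{2, −2}` (equal speed) and whose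
determinant has EXACTLY `m − 1` distinct positive zeros. [this file] -/
theorem exists_typed_equalSpeed_card_eq (m : ℕ) (hm : 1 ≤ m) :
    ∃ (c : Fin m → Fin m → ℝ) (e : Fin m → Fin m → ℕ),
      (∀ i j, c i j = c j i) ∧ (∀ i j, e i j = e j i) ∧
      (∀ i j : Fin m, (i : ℕ) + 1 < j ∨ (j : ℕ) + 1 < i → c i j = 0) ∧ (∀ i, 0 < c i i) ∧
      (∀ (t : ℕ) (ht : t + 1 < m),
        2 * (e ⟨t, by omega⟩ ⟨t + 1, ht⟩ : ℤ) - e ⟨t, by omega⟩ ⟨t, by omega⟩ - e ⟨t + 1, ht⟩ ⟨t + 1, ht⟩ = 2 ∨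
        2 * (e ⟨t, by omega⟩ ⟨t + 1, ht⟩ : ℤ) - e ⟨t, by omega⟩ ⟨t, by omega⟩ - e ⟨t + 1, ht⟩ ⟨t + 1, ht⟩ = -2) ∧
      ((Matrix.det (Matrix.of fun i j => C (c i j) * (X : ℝ[X]) ^ (e i j))).roots.toFinset.filter
        (fun t => 0 < t)).card = m - 1 := by
  obtain ⟨b, hb, hcard⟩ := exists_equalSpeed_card_eq m hm
  -- the typed design of the family
  refine ⟨fun i j => if (j : ℕ) = i then 1 else if (j : ℕ) = i + 1 then b i else if (i : ℕ) = j + 1 then b j else 0,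
    fun i j => if (j : ℕ) = i then 1 else if (j : ℕ) = i + 1 then (if (i : ℕ) % 2 = 0 then 2 else 0)
      else if (i : ℕ) = j + 1 then (if (j : ℕ) % 2 = 0 then 2 else 0) else 0,
    ?_, ?_, ?_, ?_, ?_, ?_⟩
  · intro i j
    dsimp only
    split_ifs <;> first | rfl | (exfalso; omega)
  · intro i j
    dsimp only
    split_ifs <;> first | rfl | (exfalso; omega)
  · intro i j hij
    dsimp only
    split_ifs <;> first | rfl | (exfalso; omega)
  · intro i
    simp only [if_true]
    exact one_pos
  · intro t ht
    dsimp only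
    rw [if_neg (by omega), if_pos rfl, if_pos rfl, if_pos rfl]
    by_cases h : t % 2 = 0
    · left; rw [if_pos h]; norm_num
    · right; rw [if_neg h]; norm_num
  · have hdet : (Matrix.det (Matrix.of fun i j : Fin m =>
        C ((fun i j : Fin m => if (j : ℕ) = i then (1 : ℝ) else if (j : ℕ) = i + 1 then b i else if (i : ℕ) = j + 1 then b j else 0) i j) *
          (X : ℝ[X]) ^ ((fun i j : Fin m => if (j : ℕ) = i then 1 else if (j : ℕ) = i + 1 then (if (i : ℕ) % 2 = 0 then 2 else 0)
            else if (i : ℕ) = j + 1 then (if (j : ℕ) % 2 = 0 then 2 else 0) else 0) i j))) =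
        pathDet (fun _ : ℕ => (1 : ℝ)) (fun _ : ℕ => (1 : ℕ)) b (fun t : ℕ => if t % 2 = 0 then (2 : ℕ) else 0) m := by
      rw [det_of_eq_pathDet]
      · refine pathDet_congr (fun t ht => ?_) (fun t ht => ?_) (fun t ht => ?_) (fun t ht => ?_)
        · rw [dif_pos ht]; simp
        · rw [dif_pos ht]; simp
        · rw [dif_pos ht]; simp
        · rw [dif_pos ht]; simp
      · intro i j
        split_ifs <;> first | rfl | (exfalso; omega)
      · intro i j
        split_ifs <;> first | rfl | (exfalso; omega)
      · intro i j hij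
        split_ifs <;> first | rfl | (exfalso; omega)
    rw [hdet]
    exact hcard

/-- **No row below `m − 1` is a law on the typed equal-speed sector.** [corollary] -/
theorem not_equalSpeed_law_lt (m : ℕ) (hm : 1 ≤ m) (B : ℕ) (hB : B < m - 1) :
    ¬ (∀ (c : Fin m → Fin m → ℝ) (e : Fin m → Fin m → ℕ), (∀ i j, c i j = c j i) → (∀ i j, e i j = e j i) →
        (∀ i j : Fin m, (i : ℕ) + 1 < j ∨ (j : ℕ) + 1 < i → c i j = 0) → (∀ i, 0 < c i i) →
        (∀ (t : ℕ) (ht : t + 1 < m),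
          2 * (e ⟨t, by omega⟩ ⟨t + 1, ht⟩ : ℤ) - e ⟨t, by omega⟩ ⟨t, by omega⟩ - e ⟨t + 1, ht⟩ ⟨t + 1, ht⟩ = 2 ∨
          2 * (e ⟨t, by omega⟩ ⟨t + 1, ht⟩ : ℤ) - e ⟨t, by omega⟩ ⟨t, by omega⟩ - e ⟨t + 1, ht⟩ ⟨t + 1, ht⟩ = -2) →
        ((Matrix.det (Matrix.of fun i j => C (c i j) * (X : ℝ[X]) ^ (e i j))).roots.toFinset.filter
          (fun t : ℝ => 0 < t)).card ≤ B) := by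
  intro hlaw
  obtain ⟨c, e, hc, he, hband, hpos, hslope, hcard⟩ := exists_typed_equalSpeed_card_eq m hm
  have := hlaw c e hc he hband hpos hslope
  omega

end SlopeSumRow

end Summit.ValiantsHypothesis.ValiantsHypothesis.Theorems.KPlusLogSqLaw
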